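import Summits.Schanuel.Schanuel.Theorems.RootDecomp1BMovingZero04

/-!
# RootDecomp1BMovingZero — lens 4, generation 35/36 «AX-TRANSVERSAL MOVING ZERO»: T″ = `IsolatedIntersectionGeneral` PROVED modulo ONE print fact (`CurveSelection`) + the tree Ax statement, and SUB-PIECE A = `AnalyticMovingZero` PROVED modulo TWO print facts (`RoucheMaps`, `IsolatedZeroLowerBound`) — continuation (RootDecomp1BMovingZero05): §E (1/3) exp-polynomial identity lemma, grouping by frequency, the «X constant» sub-case

(lens-4 g35 HOME kernels MovingZeroTpp.lean 6bf08f88…de4e (2338 l = §G03 MovingZeroGeneral03 b461aa70… + §E MovingZeroExpPoly fdd5ca6b… + §X MovingZeroAxGerms a74f0949… verbatim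
bodies + NEW §T) and MovingZeroPieceA.lean 8899dedb…8da9 (238 l); ADDENDUM-2 L1857, writer re-check L1858, critic RULING L1859 (T″ VERIFIED and BOOKED; `CurveSelection`
ACCEPTED as THE ONE T-fact), RESULT/DONE L1865, critic RULING/ADDENDUM L1867 (A VERIFIED and BOOKED; `RoucheMaps` / `IsolatedZeroLowerBound` ACCEPTED AS TYPED),
lens-4 g36 NOTE/CLAIM L1871 (PORT-READY) and critic ACK L1875 (PORT STAGING GO; credits T (L1859) and A (L1867) paid at the critic's verification of the
accepted parts carrying `isolatedIntersectionGeneral_of_curveSelection` resp. `analyticMovingZero_of_facts`); port by census-1 gen 17 as `RootDecomp1BMovingZero03`–`10`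
PORT EDITS: the 44 `#guard_msgs in #print axioms` guards and their section headers dropped (HOME probes); `set_option linter.dupNamespace false` dropped; PieceA's
character-identical copy of `AnalyticMovingZero` dropped (§A's definition is used; its Facts + Proof sections follow §A in part 04); the four re-proved
`AxSchanuelTwoGerms` helpers (`exists_algDerivation_eq_derivative'`, `ofPowerSeries_taylor_exp_ne_zero'`, `algebraMap_eq_ofPowerSeries_C'`, `taylor_const'`) PRIVATE in
part 08 (statement-twins of the unbuilt Literature module) with a notation-free private copy `taylor_const''` in part 09; `CurveSelection`'s docstring replaced by the
FACT (T-ii) text dictated in L1871 (ACK L1875); the three fact docstrings' cite KEYS normalised to references.bib (`Chirka1989`, `DAngeloSCV1993` — the gate's cite-key lint), locators unchanged; nine one-line docstrings added; statements and proofs otherwise verbatim; `AxRankBoundLaurent` stays a binder BY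
NAME (discharge: HOME MovingZeroAxGermsTree.lean c3203867… once `AxSchanuelUniv` builds on the farm). `--supports stmt-Schanuel-32406`; no census credit carried;
rung 0 — nothing here proves Schanuel.)
-/

noncomputable section

namespace Summit.Schanuel.Schanuel.Theorems.RootDecomp1BMovingZero

/-! # §E — `MovingZeroExpPoly.lean` (verbatim body) -/
section Epart

open Complex Filter Topology

/-- The character `x ↦ e^{μ x}` of the additive group `ℂ`, as a monoid hom on `Multiplicative ℂ`. -/
def expChar (μ : ℂ) : Multiplicative ℂ →* ℂ where
  toFun x := cexp (μ * Multiplicative.toAdd x)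
  map_one' := by simp
  map_mul' x y := by
    simp only [toAdd_mul, mul_add, Complex.exp_add]

/-- `expChar μ x = exp(μ · toAdd x)`. -/
theorem expChar_apply (μ : ℂ) (x : Multiplicative ℂ) : expChar μ x = cexp (μ * Multiplicative.toAdd x) := rfl

/-- `expChar μ (ofAdd x) = exp(μ x)`. -/
theorem expChar_ofAdd (μ x : ℂ) : expChar μ (Multiplicative.ofAdd x) = cexp (μ * x) := rfl

/-- Distinct frequencies give distinct characters: if `e^{μ x} = e^{ν x}` for all `x` then `μ = ν`
(test at `x = πi/(μ − ν)`, where the quotient character takes the value `e^{πi} = −1`). -/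
theorem expChar_injective : Function.Injective expChar := by
  intro μ ν h
  by_contra hne
  have hd : μ - ν ≠ 0 := sub_ne_zero.mpr hne
  have key := DFunLike.congr_fun h (Multiplicative.ofAdd ((Real.pi : ℂ) * I / (μ - ν)))
  simp only [expChar_ofAdd] at key
  have hsplit : cexp (μ * ((Real.pi : ℂ) * I / (μ - ν))) =
      cexp (ν * ((Real.pi : ℂ) * I / (μ - ν))) * cexp ((Real.pi : ℂ) * I) := by
    rw [← Complex.exp_add]
    congr 1
    field_simp
    ring
  rw [key, Complex.exp_pi_mul_I] at hsplit
  have hzero : cexp (ν * ((Real.pi : ℂ) * I / (μ - ν))) = 0 := by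
    linear_combination (1 / 2 : ℂ) * hsplit
  exact Complex.exp_ne_zero _ hzero

/-- **Dedekind / Artin for exponentials.** For pairwise-distinct `μᵢ ∈ ℂ` the functions `x ↦ e^{μᵢ x}` on `ℂ`
are linearly independent over `ℂ`. -/
theorem linearIndependent_cexp_mul {ι : Type*} (μ : ι → ℂ) (hμ : Function.Injective μ) :
    LinearIndependent ℂ (fun i => fun x : ℂ => cexp (μ i * x)) := by
  have h := (linearIndependent_monoidHom (Multiplicative ℂ) ℂ).comp (fun i => expChar (μ i))
    (expChar_injective.comp hμ)
  rw [linearIndependent_iff'] at h ⊢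
  intro s g hg i hi
  refine h s g ?_ i hi
  funext x
  have hx := congr_fun hg (Multiplicative.toAdd x)
  simp only [Finset.sum_apply, Pi.smul_apply, smul_eq_mul, Pi.zero_apply] at hx
  simp only [Function.comp_apply, Finset.sum_apply, Pi.smul_apply, smul_eq_mul, Pi.zero_apply,
    expChar_apply]
  exact hx

/-- **Exponential-polynomial identity lemma, global form.** If `Σᵢ cᵢ e^{μᵢ x} = 0` for every `x ∈ ℂ`, the `μᵢ`
pairwise distinct, then every `cᵢ = 0`. -/
theorem expPoly_coeff_eq_zero {ι : Type*} [Fintype ι] {μ : ι → ℂ} (hμ : Function.Injective μ)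
    {c : ι → ℂ} (h : ∀ x : ℂ, ∑ i, c i * cexp (μ i * x) = 0) : c = 0 := by
  have hli := linearIndependent_cexp_mul μ hμ
  have hc := Fintype.linearIndependent_iff.mp hli c (by
    funext x
    simpa [Finset.sum_apply, smul_eq_mul] using h x)
  funext i
  exact hc i

/-- The exponential polynomial `x ↦ Σᵢ cᵢ e^{μᵢ x}` is an entire function. -/
theorem analyticOnNhd_expPoly {ι : Type*} [Fintype ι] (μ c : ι → ℂ) :
    AnalyticOnNhd ℂ (fun x : ℂ => ∑ i, c i * cexp (μ i * x)) Set.univ := by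
  have hd : Differentiable ℂ (fun x : ℂ => ∑ i, c i * cexp (μ i * x)) := by
    refine Differentiable.fun_sum fun i _ => ?_
    exact (differentiable_const _).mul
      (Complex.differentiable_exp.comp ((differentiable_const _).mul differentiable_id))
  exact hd.differentiableOn.analyticOnNhd isOpen_univ

/-- **Exponential-polynomial identity lemma, local form.** If `Σᵢ cᵢ e^{μᵢ x} = 0` for all `x` in a
neighbourhood of some `x₀ ∈ ℂ`, the `μᵢ` pairwise distinct, then every `cᵢ = 0` (identity theorem + global form). -/
theorem expPoly_coeff_eq_zero_of_eventually {ι : Type*} [Fintype ι] {μ : ι → ℂ} (hμ : Function.Injective μ)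
    {c : ι → ℂ} {x₀ : ℂ} (h : ∀ᶠ x in 𝓝 x₀, ∑ i, c i * cexp (μ i * x) = 0) : c = 0 := by
  apply expPoly_coeff_eq_zero hμ
  have hz := (analyticOnNhd_expPoly μ c).eqOn_zero_of_preconnected_of_eventuallyEq_zero
    isPreconnected_univ (Set.mem_univ x₀) h
  intro x
  exact hz (Set.mem_univ x)

/-- **Exponential-polynomial identity lemma, accumulation form.** If the zeros of `x ↦ Σᵢ cᵢ e^{μᵢ x}` accumulate
at some `x₀` (frequently zero on the punctured neighbourhood), the `μᵢ` pairwise distinct, then every `cᵢ = 0`. -/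
theorem expPoly_coeff_eq_zero_of_frequently {ι : Type*} [Fintype ι] {μ : ι → ℂ} (hμ : Function.Injective μ)
    {c : ι → ℂ} {x₀ : ℂ} (h : ∃ᶠ x in 𝓝[≠] x₀, ∑ i, c i * cexp (μ i * x) = 0) : c = 0 := by
  apply expPoly_coeff_eq_zero hμ
  have hz := (analyticOnNhd_expPoly μ c).eqOn_zero_of_preconnected_of_frequently_eq_zero
    isPreconnected_univ (Set.mem_univ x₀) h
  intro x
  exact hz (Set.mem_univ x)

/-- **Frequency-indexed form** (the shape produced by grouping monomials by frequency): a finitely supported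
coefficient function `c : ℂ →₀ ℂ` (frequency `↦` coefficient) with `Σ_{μ ∈ supp c} c(μ) e^{μ x} = 0` near `x₀`
is zero. -/
theorem finsupp_eq_zero_of_expSum_eventually_eq_zero (c : ℂ →₀ ℂ) {x₀ : ℂ}
    (h : ∀ᶠ x in 𝓝 x₀, ∑ μ ∈ c.support, c μ * cexp (μ * x) = 0) : c = 0 := by
  have key := expPoly_coeff_eq_zero_of_eventually (ι := c.support) (μ := fun m => (m : ℂ))
    Subtype.val_injective (c := fun m => c m) (x₀ := x₀) (by
      filter_upwards [h] with x hx
      rw [← Finset.sum_coe_sort] at hx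
      simpa using hx)
  ext m
  simp only [Finsupp.coe_zero, Pi.zero_apply]
  by_contra hm
  have hmem : m ∈ c.support := by simpa [Finsupp.mem_support_iff] using hm
  have := congr_fun key ⟨m, hmem⟩
  simp only [Pi.zero_apply] at this
  exact hm this

/-! ### Grouping by frequency, and the frequency maps of T″'s log-line analysis -/

open Classical in
/-- **Grouping lemma.** With ARBITRARY (possibly repeated) frequencies: if `Σᵢ cᵢ e^{μᵢ x} = 0` near `x₀` then for
every value `φ` the coefficients of frequency `φ` sum to zero, `Σ_{i : μᵢ = φ} cᵢ = 0` (regroup into a `Finsupp`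
indexed by the distinct frequencies and apply `finsupp_eq_zero_of_expSum_eventually_eq_zero`). -/
theorem expPoly_fiber_sum_eq_zero {ι : Type*} [Fintype ι] (μ c : ι → ℂ) {x₀ : ℂ}
    (h : ∀ᶠ x in 𝓝 x₀, ∑ i, c i * cexp (μ i * x) = 0) (φ : ℂ) :
    ∑ i ∈ Finset.univ.filter (fun i => μ i = φ), c i = 0 := by
  set d : ℂ →₀ ℂ := ∑ i, Finsupp.single (μ i) (c i) with hd
  have hsum : ∀ x : ℂ, ∑ ν ∈ d.support, d ν * cexp (ν * x) = ∑ i, c i * cexp (μ i * x) := by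
    intro x
    have key : (d.sum fun ν a => a * cexp (ν * x)) = ∑ i, c i * cexp (μ i * x) := by
      rw [hd, ← Finsupp.sum_finsetSum_index]
      · simp [Finsupp.sum_single_index]
      · intro ν; simp
      · intro ν a b; ring
    simpa [Finsupp.sum] using key
  have hd0 : d = 0 := finsupp_eq_zero_of_expSum_eventually_eq_zero d (x₀ := x₀) (by
    filter_upwards [h] with x hx
    rw [hsum x]; exact hx)
  have happ : d φ = ∑ i ∈ Finset.univ.filter (fun i => μ i = φ), c i := by
    rw [hd, Finsupp.finsetSum_apply, Finset.sum_filter]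
    refine Finset.sum_congr rfl fun i _ => ?_
    rw [Finsupp.single_apply]
  rw [← happ, hd0, Finsupp.coe_zero, Pi.zero_apply]

/-- For IRRATIONAL real `ρ` the frequencies `j + kρ` (`j, k ∈ ℤ`) are pairwise distinct (the sub-case «`X` constant
on the branch» of T″: `F₂(X₀, ·) ≡ 0` forces every `G₂ₖ(ρ, X₀, ·) = 0`). -/
theorem injective_freq₂ {ρ : ℝ} (hρ : Irrational ρ) :
    Function.Injective (fun p : ℤ × ℤ => (p.1 : ℝ) + p.2 * ρ) := by
  intro p q h
  simp only at h
  by_cases hk : p.2 = q.2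
  · have h1 : (p.1 : ℝ) = q.1 := by rw [hk] at h; linarith
    exact Prod.ext (by exact_mod_cast h1) hk
  · exfalso
    have hne : (p.2 : ℝ) - q.2 ≠ 0 := by exact_mod_cast sub_ne_zero.mpr hk
    have hρeq : ρ = ((q.1 : ℝ) - p.1) / ((p.2 : ℝ) - q.2) := by
      field_simp
      linarith
    exact hρ ⟨((q.1 - p.1 : ℤ) : ℚ) / ((p.2 - q.2 : ℤ) : ℚ), by rw [hρeq]; push_cast; ring⟩

/-- The same frequencies read in `ℂ`. -/
theorem injective_freq₂' {ρ : ℝ} (hρ : Irrational ρ) :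
    Function.Injective (fun p : ℤ × ℤ => (p.1 : ℂ) + p.2 * (ρ : ℂ)) := by
  have : (fun p : ℤ × ℤ => (p.1 : ℂ) + p.2 * (ρ : ℂ)) = (fun r : ℝ => (r : ℂ)) ∘ (fun p : ℤ × ℤ => (p.1 : ℝ) + p.2 * ρ) := by
    funext p; simp
  rw [this]
  exact Complex.ofReal_injective.comp (injective_freq₂ hρ)

/-- If `1, lam, ρ` are `ℚ`-linearly independent, the frequencies `j + l·lam + k·ρ` (`j, l, k ∈ ℤ`) are pairwise
distinct (the sub-case «`1, λ, ρ` free» of T″'s log-line analysis: all coefficients of `F₁|_γ` vanish). -/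
theorem injective_freq₃ {lam ρ : ℝ} (h : LinearIndependent ℚ ![(1 : ℝ), lam, ρ]) :
    Function.Injective (fun p : ℤ × ℤ × ℤ => (p.1 : ℝ) + p.2.1 * lam + p.2.2 * ρ) := by
  intro p q hpq
  simp only at hpq
  have hli := Fintype.linearIndependent_iff.mp h
    (![((p.1 - q.1 : ℤ) : ℚ), ((p.2.1 - q.2.1 : ℤ) : ℚ), ((p.2.2 - q.2.2 : ℤ) : ℚ)]) (by
      simp only [Fin.sum_univ_three, Matrix.cons_val_zero, Matrix.cons_val_one, Matrix.cons_val]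
      simp only [Rat.smul_def]
      push_cast
      linarith)
  have h0 := hli 0
  have h1 := hli 1
  have h2 := hli 2
  simp only [Matrix.cons_val_zero, Matrix.cons_val_one, Matrix.cons_val, Int.cast_eq_zero, sub_eq_zero]
    at h0 h1 h2
  exact Prod.ext h0 (Prod.ext h1 h2)

/-- The same frequencies read in `ℂ`. -/
theorem injective_freq₃' {lam ρ : ℝ} (h : LinearIndependent ℚ ![(1 : ℝ), lam, ρ]) :
    Function.Injective (fun p : ℤ × ℤ × ℤ => (p.1 : ℂ) + p.2.1 * (lam : ℂ) + p.2.2 * (ρ : ℂ)) := by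
  have : (fun p : ℤ × ℤ × ℤ => (p.1 : ℂ) + p.2.1 * (lam : ℂ) + p.2.2 * (ρ : ℂ)) =
      (fun r : ℝ => (r : ℂ)) ∘ (fun p : ℤ × ℤ × ℤ => (p.1 : ℝ) + p.2.1 * lam + p.2.2 * ρ) := by
    funext p; simp
  rw [this]
  exact Complex.ofReal_injective.comp (injective_freq₃ h)

/-! ### The sub-case «`X` constant on the branch» of T″, at the polynomial level -/

/-- **Sub-case `B = 0` of T″ (RULING L1839), polynomial core.** For IRRATIONAL real `ρ` and complex polynomials
`g₀, …, g_K`: if `Σ_k g_k(e^{y}) e^{kρ y} = 0` for all `y` near some `y₀` then every `g_k = 0`.  (Expanding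
`g_k(e^y) = Σ_j a_{kj} e^{j y}` gives an exponential polynomial with frequencies `j + kρ`, pairwise distinct by
`injective_freq₂'`; apply `expPoly_coeff_eq_zero_of_eventually`.)  In T″: `X ≡ X₀` on the branch forces
`F₂(X₀, Y) ≡ 0` near `Y₀`, i.e. (with `Y = e^y`) the displayed identity for `g_k = G₂ₖ(ρ, X₀, ·)`, so the top
coefficient `G₂K₂(ρ, X₀, ·)` vanishes at `Y₀` — contradicting `GenuineAt`. -/
theorem poly_family_eq_zero_of_expSum {K : ℕ} {ρ : ℝ} (hρ : Irrational ρ) (g : Fin (K + 1) → Polynomial ℂ)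
    {y₀ : ℂ} (h : ∀ᶠ y in 𝓝 y₀, ∑ k : Fin (K + 1), (g k).eval (cexp y) * cexp (((k : ℕ) : ℂ) * (ρ : ℂ) * y) = 0) :
    ∀ k, g k = 0 := by
  classical
  set D : ℕ := Finset.univ.sup fun k => (g k).natDegree with hD
  have hdeg : ∀ k, (g k).natDegree < D + 1 := fun k =>
    Nat.lt_succ_of_le (Finset.le_sup (f := fun k => (g k).natDegree) (Finset.mem_univ k))
  have hμ : Function.Injective
      (fun q : Fin (K + 1) × Fin (D + 1) => ((q.2 : ℕ) : ℂ) + ((q.1 : ℕ) : ℂ) * (ρ : ℂ)) := by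
    intro a b hab
    simp only at hab
    have h2 := @injective_freq₂' ρ hρ (((a.2 : ℕ) : ℤ), ((a.1 : ℕ) : ℤ)) (((b.2 : ℕ) : ℤ), ((b.1 : ℕ) : ℤ))
      (by push_cast; exact hab)
    simp only [Prod.mk.injEq, Nat.cast_inj] at h2
    exact Prod.ext (Fin.ext h2.2) (Fin.ext h2.1)
  have hexp : ∀ y : ℂ,
      ∑ q : Fin (K + 1) × Fin (D + 1), (g q.1).coeff q.2 * cexp ((((q.2 : ℕ) : ℂ) + ((q.1 : ℕ) : ℂ) * (ρ : ℂ)) * y)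
        = ∑ k : Fin (K + 1), (g k).eval (cexp y) * cexp (((k : ℕ) : ℂ) * (ρ : ℂ) * y) := by
    intro y
    rw [Fintype.sum_prod_type]
    refine Finset.sum_congr rfl fun k _ => ?_
    rw [Polynomial.eval_eq_sum_range' (hdeg k), Finset.sum_range (fun j => (g k).coeff j * cexp y ^ j),
      Finset.sum_mul]
    refine Finset.sum_congr rfl fun j _ => ?_
    rw [add_mul, Complex.exp_add, ← Complex.exp_nat_mul]
    ring
  have key := expPoly_coeff_eq_zero_of_eventually hμ (c := fun q => (g q.1).coeff q.2) (x₀ := y₀) (by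
    filter_upwards [h] with y hy
    rw [hexp y]
    exact hy)
  intro k
  ext j
  simp only [Polynomial.coeff_zero]
  by_cases hj : j < D + 1
  · exact congr_fun key (k, ⟨j, hj⟩)
  · exact Polynomial.coeff_eq_zero_of_natDegree_lt (by have := hdeg k; omega)

end Epart

end Summit.Schanuel.Schanuel.Theorems.RootDecomp1BMovingZero

end
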